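import Mathlib
import Summits.NavierStokesRegularity.NavierStokesRegularity.Theorems.TaoLadderRungTwoBreakDSSWaveOfDSSOrbit
import Summits.NavierStokesRegularity.NavierStokesRegularity.Theorems.TaoLadderRungTwoBreakDSSOrbitOfOneShiftDatum
import HarnessLib

/-!
# One-shift datum of the bi-infinite cascade lattice ⟹ admissible (surviving) DSS wave
# (`IsDSSWave`), kernel form of `rung1/STAGE2-LEMMA.md` §4 COROLLARY (cell harvest/h2-tao-ladder,
# seat p2; support for K1(1) = `TaoLadderRungTwoBreak.NoSurvivingDSSOne`, stmt-NavierStokesRegularity-20205)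

MODEL statement about the cascade lattice ODE of a table `α` (Tao 2016 §4, tree normal form with
`Λ = bigLam ε₀`); nothing here is a statement about the Navier–Stokes equations; no item is closed.

Composition of `DSSOneShift.exists_dssOrbit_of_oneShiftDatum` (glued DSS orbit) with
`DSSOneShift.isDSSWave_of_dssOrbit` (orbit ⟹ wave).  The two admissibility clauses of `IsDSSWave`
are discharged from SHELL-WISE AMPLITUDE BOUNDS OF THE DATUM on the closed flight `[0, τ]`:
* `dssOrbit_norm_le`: if the wake shells obey `‖U_{-n}‖ ≤ P gⁿ` (`n ∈ ℕ`; physical amplitude left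
  behind bounded) then `‖u‖ ≤ P` on `[0, t⋆)` — the flights `j ≥ 0` cover `[0, t⋆)`;
* `integrableOn_dssOrbit`: if `‖U_{-j}‖ ≤ M_j` on `[0, τ]` with `Σ_{j ∈ ℤ} e^{-jT} g^{-j} M_j < ∞`
  then `‖u‖` is integrable on `(-∞, t⋆)` — flight `j` has length `e^{-jT}τ` and amplitude `g^{-j}`
  (for a certificate: wake `M_{n} ≤ C_w gⁿ` gives terms `C_w τ e^{-nT}`, top `M_{-n} ≤ C_t Γ^{-n}`
  gives `C_t τ (Λ/Γ)ⁿ`, summable for `Γ > Λ` — `rung1/STAGE2-LEMMA.md` §2 weights);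
* `isDSSWave_of_oneShiftDatum`: datum + these bounds ⟹ `∃ Φ, IsDSSWave ε₀ α (Equiv.refl Unit) T Φ`,
  non-trivial when `U_0 ≢ 0` on `[0, τ)`; with `1 < g² ≤ 1 + ε₀` the wave is (S₁)-SURVIVING
  (`exists_surviving_dssWave_of_oneShiftDatum`) — the object `NoSurvivingDSSOne` says is trivial
  below its threshold `ε_s(R)`, so every interval-certified one-shift fixed point with `s ≥ 1`,
  `μ < 1` of an `R`-comparable table bounds `ε_s(R)` from above through this file.
The one remaining non-kernel link is «certificate ⟹ one-shift datum of the bi-infinite lattice»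
(`rung1/STAGE2-LEMMA.md` §2–§4, Schauder–Tychonoff).
-/

noncomputable section

-- `Summit.NavierStokesRegularity.NavierStokesRegularity.…` is the tree's (summit = problem) namespace; the
-- duplicated component is intended, so the dupNamespace linter is silenced for this file.
set_option linter.dupNamespace false

namespace Summit.NavierStokesRegularity.NavierStokesRegularity.Theorems

namespace DSSOneShift

open Filter Topology MeasureTheory Set
open Literature.Analysis.FluidPDE Literature.Analysis.FluidPDE.TaoCascade
open WakeRatchetCritical

section Bounds

variable {V : Type*} [NormedAddCommGroup V] [NormedSpace ℝ V]

/-- `t⋆ > 0` when `τ = t⋆(1 - e^{-T})` with `τ, T > 0`. [folklore] -/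
theorem tstar_pos {τ T tstar : ℝ} (hT : 0 < T) (hτ : 0 < τ)
    (htstar : τ = tstar * (1 - Real.exp (-T))) : 0 < tstar := by
  have hE1 : Real.exp (-T) < 1 := by
    rw [← Real.exp_zero]; exact Real.exp_lt_exp.2 (by linarith)
  by_contra h
  have : tstar * (1 - Real.exp (-T)) ≤ 0 :=
    mul_nonpos_of_nonpos_of_nonneg (not_lt.1 h) (by linarith)
  linarith

/-- Flight `j` has length `e^{-jT}τ`: `t_{j+1} - t_j = e^{-jT} τ`. [folklore] -/
theorem flight_gap {τ T tstar : ℝ} (htstar : τ = tstar * (1 - Real.exp (-T))) (j : ℤ) :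
    (tstar - tstar * Real.exp (-(((j : ℝ) + 1) * T))) - (tstar - tstar * Real.exp (-((j : ℝ) * T)))
      = Real.exp (-((j : ℝ) * T)) * τ := by
  have e2 : Real.exp (-(((j : ℝ) + 1) * T)) = Real.exp (-((j : ℝ) * T)) * Real.exp (-T) := by
    rw [← Real.exp_add]; ring_nf
  rw [e2, htstar]; ring

/-- **Bound near the blow-up time.**  If `u` has the flight structure of a glued DSS orbit
(`u(t_j + e^{-jT}s) = g^{-j} U_{-j}(s)`, flights covering `(-∞, t⋆)`) and the wake shells of the
datum obey `‖U_{-n}(s)‖ ≤ P gⁿ` on `[0, τ)`, then `‖u(t)‖ ≤ P` for `0 ≤ t < t⋆`.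
[cite: Tao2016AveragedNS, §5.3–§6 (self-similar blow-up); cell vocabulary, harvest/h2-tao-ladder rung1/STAGE2-LEMMA.md §4 Corollary (bdd)] -/
theorem dssOrbit_norm_le {u : ℝ → V} {U : ℤ → ℝ → V} {g T tstar τ P : ℝ}
    (hg : 0 < g) (hT : 0 < T) (hτ : 0 < τ) (htstar : τ = tstar * (1 - Real.exp (-T)))
    (hflight : ∀ (j : ℤ) (s : ℝ), s ∈ Ico 0 τ →
        u (tstar - tstar * Real.exp (-((j : ℝ) * T)) + Real.exp (-((j : ℝ) * T)) * s)
          = (g ^ j)⁻¹ • U (-j) s)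
    (hcover : ∀ t, t < tstar → ∃ (j : ℤ) (s : ℝ), s ∈ Ico 0 τ ∧
        t = tstar - tstar * Real.exp (-((j : ℝ) * T)) + Real.exp (-((j : ℝ) * T)) * s)
    (hP : ∀ (n : ℕ) (s : ℝ), s ∈ Ico 0 τ → ‖U (-(n : ℤ)) s‖ ≤ P * g ^ n) :
    ∀ t, 0 ≤ t → t < tstar → ‖u t‖ ≤ P := by
  intro t ht0 ht
  have htp := tstar_pos hT hτ htstar
  obtain ⟨j, s, hs, rfl⟩ := hcover t ht
  have hj : 0 ≤ j := by
    by_contra hneg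
    have hj1 : ((j : ℝ) + 1) ≤ 0 := by exact_mod_cast (show j + 1 ≤ 0 by omega)
    have hexp : 1 ≤ Real.exp (-(((j : ℝ) + 1) * T)) := by
      have h0 : 0 ≤ -(((j : ℝ) + 1) * T) := by nlinarith
      linarith [Real.add_one_le_exp (-(((j : ℝ) + 1) * T))]
    have hgap := flight_gap htstar j
    have hlt : Real.exp (-((j : ℝ) * T)) * s < Real.exp (-((j : ℝ) * T)) * τ :=
      mul_lt_mul_of_pos_left hs.2 (Real.exp_pos _)
    nlinarith
  obtain ⟨n, rfl⟩ := Int.eq_ofNat_of_zero_le hj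
  rw [hflight n s hs, norm_smul, norm_inv, zpow_natCast, norm_pow, Real.norm_eq_abs, abs_of_pos hg]
  have hgn : 0 < g ^ n := pow_pos hg n
  rw [inv_mul_le_iff₀ hgn, mul_comm]
  exact hP n s hs

/-- **Finite physical-time action.**  If `u` has the flight structure of a glued DSS orbit, the datum
shells are continuous on `[0, τ]` with `‖U_{-j}‖ ≤ M_j`, and `Σ_j e^{-jT} g^{-j} M_j < ∞`, then `‖u‖`
is integrable on `(-∞, t⋆)` (flight `j` contributes at most `τ e^{-jT} g^{-j} M_j`).
[cite: Tao2016AveragedNS, §5.3–§6 (self-similar blow-up); cell vocabulary, harvest/h2-tao-ladder rung1/STAGE2-LEMMA.md §4 Corollary (mass)] -/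
theorem integrableOn_dssOrbit {u : ℝ → V} {U : ℤ → ℝ → V} {g T tstar τ : ℝ} {M : ℤ → ℝ}
    (hg : 0 < g) (hτ : 0 < τ) (htstar : τ = tstar * (1 - Real.exp (-T)))
    (hcont : ∀ k : ℤ, ContinuousOn (U k) (Icc 0 τ))
    (hflight : ∀ (j : ℤ) (s : ℝ), s ∈ Ico 0 τ →
        u (tstar - tstar * Real.exp (-((j : ℝ) * T)) + Real.exp (-((j : ℝ) * T)) * s)
          = (g ^ j)⁻¹ • U (-j) s)
    (hcover : ∀ t, t < tstar → ∃ (j : ℤ) (s : ℝ), s ∈ Ico 0 τ ∧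
        t = tstar - tstar * Real.exp (-((j : ℝ) * T)) + Real.exp (-((j : ℝ) * T)) * s)
    (hM : ∀ (j : ℤ) (s : ℝ), s ∈ Icc 0 τ → ‖U (-j) s‖ ≤ M j)
    (hsum : Summable fun j : ℤ => Real.exp (-((j : ℝ) * T)) * ((g ^ j)⁻¹ * M j)) :
    IntegrableOn (fun t => ‖u t‖) (Iio tstar) := by
  -- the flights `S j = [t_j, t_{j+1})`
  obtain ⟨ts, hts⟩ : ∃ ts : ℤ → ℝ, ∀ j, ts j = tstar - tstar * Real.exp (-((j : ℝ) * T)) :=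
    ⟨_, fun _ => rfl⟩
  have hts_succ : ∀ j : ℤ, ts (j + 1) = tstar - tstar * Real.exp (-(((j : ℝ) + 1) * T)) := by
    intro j; rw [hts]; push_cast; ring_nf
  have hgap : ∀ j : ℤ, ts (j + 1) - ts j = Real.exp (-((j : ℝ) * T)) * τ := by
    intro j; rw [hts_succ, hts]; exact flight_gap htstar j
  have hinv : ∀ j : ℤ, Real.exp ((j : ℝ) * T) * Real.exp (-((j : ℝ) * T)) = 1 := by
    intro j; rw [← Real.exp_add, add_neg_cancel, Real.exp_zero]
  -- they cover `(-∞, t⋆)`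
  have hcov : Iio tstar ⊆ ⋃ j : ℤ, Ico (ts j) (ts (j + 1)) := by
    intro t ht
    obtain ⟨j, s, hs, rfl⟩ := hcover t ht
    have h1 := hgap j
    have h2 := hts j
    have h3 : 0 ≤ Real.exp (-((j : ℝ) * T)) * s := mul_nonneg (Real.exp_pos _).le hs.1
    have h4 : Real.exp (-((j : ℝ) * T)) * s < Real.exp (-((j : ℝ) * T)) * τ :=
      mul_lt_mul_of_pos_left hs.2 (Real.exp_pos _)
    refine mem_iUnion.2 ⟨j, ?_, ?_⟩
    · linarith
    · linarith
  -- on flight `j`, `‖u‖` is the norm of a continuous reparametrisation of `U_{-j}`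
  have hF_cont : ∀ j : ℤ, ContinuousOn
      (fun t => ‖(g ^ j)⁻¹ • U (-j) (Real.exp ((j : ℝ) * T) * (t - ts j))‖)
      (Icc (ts j) (ts (j + 1))) := by
    intro j
    have hmaps : MapsTo (fun t => Real.exp ((j : ℝ) * T) * (t - ts j)) (Icc (ts j) (ts (j + 1)))
        (Icc 0 τ) := by
      intro t ht
      have h1 := hgap j
      constructor
      · exact mul_nonneg (Real.exp_pos _).le (by linarith [ht.1])
      · have : Real.exp ((j : ℝ) * T) * (t - ts j) ≤ Real.exp ((j : ℝ) * T) * (ts (j + 1) - ts j) :=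
          mul_le_mul_of_nonneg_left (by linarith [ht.2]) (Real.exp_pos _).le
        rw [h1, ← mul_assoc, hinv, one_mul] at this
        exact this
    have hc : ContinuousOn (fun t => U (-j) (Real.exp ((j : ℝ) * T) * (t - ts j)))
        (Icc (ts j) (ts (j + 1))) :=
      (hcont (-j)).comp (by fun_prop) hmaps
    exact (hc.const_smul ((g ^ j)⁻¹)).norm
  have hEq : ∀ j : ℤ, EqOn (fun t => ‖(g ^ j)⁻¹ • U (-j) (Real.exp ((j : ℝ) * T) * (t - ts j))‖)
      (fun t => ‖u t‖) (Ico (ts j) (ts (j + 1))) := by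
    intro j t ht
    have h1 := hgap j
    have hs : Real.exp ((j : ℝ) * T) * (t - ts j) ∈ Ico 0 τ := by
      constructor
      · exact mul_nonneg (Real.exp_pos _).le (by linarith [ht.1])
      · have : Real.exp ((j : ℝ) * T) * (t - ts j) < Real.exp ((j : ℝ) * T) * (ts (j + 1) - ts j) :=
          mul_lt_mul_of_pos_left (by linarith [ht.2]) (Real.exp_pos _)
        rw [h1, ← mul_assoc, hinv, one_mul] at this
        exact this
    have h2 := hflight j _ hs
    have hpt : tstar - tstar * Real.exp (-((j : ℝ) * T))
        + Real.exp (-((j : ℝ) * T)) * (Real.exp ((j : ℝ) * T) * (t - ts j)) = t := by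
      rw [← mul_assoc, mul_comm (Real.exp _), hinv, one_mul, hts]; ring
    rw [hpt] at h2
    simp only [h2]
  have hint_j : ∀ j : ℤ, IntegrableOn (fun t => ‖u t‖) (Ico (ts j) (ts (j + 1))) := fun j =>
    (((hF_cont j).integrableOn_Icc).mono_set Ico_subset_Icc_self).congr_fun (hEq j)
      measurableSet_Ico
  -- flight `j` contributes at most `τ e^{-jT} g^{-j} M_j`
  have hbound : ∀ j : ℤ, ∫ t in Ico (ts j) (ts (j + 1)), ‖u t‖
      ≤ τ * (Real.exp (-((j : ℝ) * T)) * ((g ^ j)⁻¹ * M j)) := by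
    intro j
    have hgj : 0 < g ^ j := zpow_pos hg j
    have hC : ∀ t ∈ Ico (ts j) (ts (j + 1)), ‖(‖u t‖)‖ ≤ (g ^ j)⁻¹ * M j := by
      intro t ht
      have e : ‖(g ^ j)⁻¹ • U (-j) (Real.exp ((j : ℝ) * T) * (t - ts j))‖ = ‖u t‖ := hEq j ht
      rw [norm_norm, ← e, norm_smul, norm_inv, Real.norm_eq_abs, abs_of_pos hgj]
      refine mul_le_mul_of_nonneg_left (hM j _ ⟨?_, ?_⟩) (inv_nonneg.2 hgj.le)
      · exact mul_nonneg (Real.exp_pos _).le (by linarith [ht.1])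
      · have h1 := hgap j
        have : Real.exp ((j : ℝ) * T) * (t - ts j) ≤ Real.exp ((j : ℝ) * T) * (ts (j + 1) - ts j) :=
          mul_le_mul_of_nonneg_left (by linarith [ht.2]) (Real.exp_pos _).le
        rw [h1, ← mul_assoc, hinv, one_mul] at this
        exact this
    have h := norm_setIntegral_le_of_norm_le_const (μ := volume)
      (measure_Ico_lt_top : volume (Ico (ts j) (ts (j + 1))) < ⊤) hC
    rw [Real.volume_real_Ico_of_le (by linarith [hgap j, mul_pos (Real.exp_pos (-((j : ℝ) * T))) hτ]),
      hgap j] at h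
    have hnn : 0 ≤ ∫ t in Ico (ts j) (ts (j + 1)), ‖u t‖ := integral_nonneg fun _ => norm_nonneg _
    rw [Real.norm_eq_abs, abs_of_nonneg hnn] at h
    linarith
  have hsum' : Summable fun j : ℤ => ∫ t in Ico (ts j) (ts (j + 1)), ‖(‖u t‖)‖ := by
    simp only [norm_norm]
    exact Summable.of_nonneg_of_le (fun j => integral_nonneg fun _ => norm_nonneg _) hbound
      (hsum.mul_left τ)
  exact (integrableOn_iUnion_of_summable_integral_norm hint_j hsum').mono_set hcov

end Bounds

/-! ## Table level: the admissible DSS wave of a one-shift datum -/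

section Table

variable {m : ℕ}

/-- **One-shift datum ⟹ admissible DSS wave.**  Let `U` be a one-shift datum of the lattice of
the table `α` at scale ratio `1+ε₀` (every shell solves the normal form
`U_k' = Λ^k (Q(U_k) + Λ⁻¹A(U_{k-1}) + B(U_{k+1}, U_k))` on `[0, τ]`, `g • U_{k+1}(τ) = U_k(0)`,
`Λ = g e^{T}`, `g > 0`, `T > 0`, `τ = t⋆(1 - e^{-T})`), with shell bounds `‖U_{-j}‖ ≤ M_j` on
`[0, τ]`, `Σ_j e^{-jT} g^{-j} M_j < ∞` and `M_n ≤ P gⁿ` for `n ∈ ℕ`.  Then the table carries an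
admissible DSS wave with ONE profile and delay `T` (per-shell energy ratio `dssMu ε₀ T = g⁻²`,
`dssMu_eq_of_bigLam_eq`), non-trivial as soon as `U_0 ≢ 0` on `[0, τ)`.
[cite: Tao2016AveragedNS, §4 Lemma 4.1 (4.8), §5.3–§6; cell vocabulary (`IsDSSWave`), harvest/h2-tao-ladder rung1/STAGE2-LEMMA.md §1–§4] -/
theorem isDSSWave_of_oneShiftDatum {ε₀ : ℝ} {α : Fin m → Fin m → Fin m → ℤ × ℤ × ℤ → ℝ}
    {g T tstar τ P : ℝ} {M : ℤ → ℝ} (hg : 0 < g) (hT : 0 < T)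
    (hlam : bigLam ε₀ = g * Real.exp T) (hτ : 0 < τ) (htstar : τ = tstar * (1 - Real.exp (-T)))
    {U : ℤ → ℝ → Em m}
    (hU : ∀ (k : ℤ) (s : ℝ), s ∈ Icc 0 τ → HasDerivWithinAt (U k)
      (bigLam ε₀ ^ k • (tableQ α (U k s) + (bigLam ε₀)⁻¹ • tableA α (U (k - 1) s)
        + tableB α (U (k + 1) s) (U k s))) (Icc 0 τ) s)
    (hshift : ∀ k : ℤ, g • U (k + 1) τ = U k 0)
    (hM : ∀ (j : ℤ) (s : ℝ), s ∈ Icc 0 τ → ‖U (-j) s‖ ≤ M j)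
    (hsum : Summable fun j : ℤ => Real.exp (-((j : ℝ) * T)) * ((g ^ j)⁻¹ * M j))
    (hP : ∀ n : ℕ, M n ≤ P * g ^ n) :
    ∃ Φ : Unit → ℝ → Em m, IsDSSWave ε₀ α (Equiv.refl Unit) T Φ ∧
      ((∃ s ∈ Ico 0 τ, U 0 s ≠ 0) → ∃ x, Φ () x ≠ 0) := by
  have htp := tstar_pos hT hτ htstar
  obtain ⟨u, hlaw, hfl, hcov⟩ := exists_dssOrbit_of_oneShiftDatum (V := Em m) (Q := tableQ α)
    (A₀ := fun v => (bigLam ε₀)⁻¹ • tableA α v) (B₀ := tableB α) (tableQ_smul α)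
    (fun c v => by
      show (bigLam ε₀)⁻¹ • tableA α (c • v) = c ^ 2 • (bigLam ε₀)⁻¹ • tableA α v
      rw [tableA_smul, smul_comm])
    (fun c v w => by
      show tableB α (c • v) w = c • tableB α v w
      simpa using tableB_smul_smul α c 1 v w)
    (fun c v w => by
      show tableB α v (c • w) = c • tableB α v w
      simpa using tableB_smul_smul α 1 c v w)
    hg hT hlam hτ htstar hU hshift
  refine ⟨fun _ x => Real.exp (-x) • u (tstar - Real.exp (-x)), ?_, ?_⟩
  · refine isDSSWave_of_dssOrbit (Um := fun t => g • u (tstar - Real.exp (-T) * (tstar - t)))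
      (Up := fun t => g⁻¹ • u (tstar - Real.exp T * (tstar - t))) (θ₀ := tstar) (P := P)
      hg hT hlam hlaw ?_ ?_ ?_ htp ?_
    · intro θ _; simp only [sub_sub_cancel]
    · intro θ _; simp only [sub_sub_cancel]
    · exact integrableOn_dssOrbit hg hτ htstar (fun k s hs => (hU k s hs).continuousWithinAt)
        hfl hcov hM hsum
    · intro θ hθ hθle
      refine dssOrbit_norm_le hg hT hτ htstar hfl hcov (fun n s hs => ?_) _ (by linarith) (by linarith)
      exact (hM n s (Ico_subset_Icc_self hs)).trans (hP n)
  · rintro ⟨s₀, hs₀, hne⟩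
    have hτlt : τ < tstar := by
      rw [htstar]; nlinarith [Real.exp_pos (-T)]
    have hu0 : u s₀ = U 0 s₀ := by
      have := hfl 0 s₀ hs₀
      simpa using this
    have hne' : u s₀ ≠ 0 := by rwa [hu0]
    obtain ⟨x, hx⟩ := not_forall.1 (dssProfile_ne_zero (U₀ := u) (lt_trans hs₀.2 hτlt) hne')
    exact ⟨x, hx⟩

/-- **One-shift datum with `1 < g² ≤ 1 + ε₀` ⟹ a NON-TRIVIAL (S₁)-SURVIVING admissible DSS wave**
— the object that `NoSurvivingDSSOne` (K1(1), stmt 20205) asserts to be trivial for all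
`R`-comparable tables once `ε₀ ≤ ε_s(R)`.  So an interval certificate of such a datum for a table
in `InTableClass R` at scale ratio `1+ε₀` gives `ε_s(R) < ε₀` for every admissible threshold.
[cite: Tao2016AveragedNS, §4 (the viscous equation before Thm. 4.2), §5.3–§6; cell vocabulary (`IsDSSWave`, `Surviving`), harvest/h2-tao-ladder rung1/STAGE2-LEMMA.md §4–§5] -/
theorem exists_surviving_dssWave_of_oneShiftDatum {ε₀ : ℝ}
    {α : Fin m → Fin m → Fin m → ℤ × ℤ × ℤ → ℝ}
    {g T tstar τ P : ℝ} {M : ℤ → ℝ} (hε : 0 < 1 + ε₀) (hg : 0 < g) (hT : 0 < T)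
    (hlam : bigLam ε₀ = g * Real.exp T) (hτ : 0 < τ) (htstar : τ = tstar * (1 - Real.exp (-T)))
    {U : ℤ → ℝ → Em m}
    (hU : ∀ (k : ℤ) (s : ℝ), s ∈ Icc 0 τ → HasDerivWithinAt (U k)
      (bigLam ε₀ ^ k • (tableQ α (U k s) + (bigLam ε₀)⁻¹ • tableA α (U (k - 1) s)
        + tableB α (U (k + 1) s) (U k s))) (Icc 0 τ) s)
    (hshift : ∀ k : ℤ, g • U (k + 1) τ = U k 0)
    (hM : ∀ (j : ℤ) (s : ℝ), s ∈ Icc 0 τ → ‖U (-j) s‖ ≤ M j)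
    (hsum : Summable fun j : ℤ => Real.exp (-((j : ℝ) * T)) * ((g ^ j)⁻¹ * M j))
    (hP : ∀ n : ℕ, M n ≤ P * g ^ n)
    (hg1 : 1 < g ^ 2) (hg2 : g ^ 2 ≤ 1 + ε₀) (hne : ∃ s ∈ Ico 0 τ, U 0 s ≠ 0) :
    ∃ Φ : Unit → ℝ → Em m, IsDSSWave ε₀ α (Equiv.refl Unit) T Φ ∧ Surviving 1 ε₀ T ∧
      ∃ x, Φ () x ≠ 0 := by
  obtain ⟨Φ, hΦ, hnt⟩ := isDSSWave_of_oneShiftDatum hg hT hlam hτ htstar hU hshift hM hsum hP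
  exact ⟨Φ, hΦ, (surviving_one_iff_of_bigLam_eq hε hg hlam).2 ⟨hg1, hg2⟩, hnt hne⟩

end Table

end DSSOneShift

end Summit.NavierStokesRegularity.NavierStokesRegularity.Theorems
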